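import Mathlib.Analysis.Calculus.Deriv.MeanValue
import Mathlib.Analysis.SpecialFunctions.Sqrt
import Mathlib.MeasureTheory.Integral.IntervalIntegral.FundThmCalculus
import Mathlib.Topology.Order.IntermediateValue
import Literature.ComputerArithmetic.BrentZimmermann2010.AsymptoticExpansions

/-!
HONEST FRAMING: exact (Metropolis-corrected) sampling algorithms for lattice gauge theory; figures
of merit are autocorrelation/cost numbers at stated couplings and volumes; no continuum-physics
claim.

# SwapSpacingOptimum — IN THE GAUSSIAN SWAP MODEL THE PAIR EFFICIENCY `u²·erfc u` (`u = ℓ/(2√2)`,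
# `ℓ` the stiffness distance of two replicas) HAS A UNIQUE MAXIMISER `u⋆`, CHARACTERISED BY
# `erfc(u⋆) = u⋆e^{−u⋆²}/√π`; THE MODEL'S OPTIMAL SWAP ACCEPTANCE IS `a⋆ = erfc(u⋆)` (row 22 `su3-ptbc`,
# GEN-4, ours; part 1 of 2 — physical units, universality in the total stiffness and the certified
# enclosure `0.230 < a⋆ < 0.237` are the companion file `SwapAcceptanceOptimum`)

Venture `LatticeQCDFlow` (cell pub-lqcd), topic `Scaling`; FANOUT row 22 (`su3-ptbc`, PTBC comparator arm
E4).  NEW WORK of the cell = elementary calculus over the tree's `erf`/`erfc`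
(`Literature.Analysis.SpecialFunctions.Erf`: `erf x = (2/√π)∫₀ˣe^{−t²}`;
`Literature.ComputerArithmetic.BrentZimmermann2010.AsymptoticExpansions`: `erfc = 1 − erf`, `erfc_pos`,
`erfc_lt_leadFactor` = `erfc x < e^{−x²}/(x√π)`).  Nothing here is cited as a fact.  It types the MODEL
behind the card's tuning lever `swap_acc_target = 0.20` (HOME `su3-ptbc/CARD-su3-ptbc.md` §1.5–§1.6, §2:
"swap acceptance target `p* = 20 %` uniform", the printed practice of Bonanno–Bonati–D'Elia 2021 /
arXiv:2510.08006) — why ONE acceptance number is the right tuning target at every `(β, L, L_d)`, and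
which number the model prefers.

## The model (two printed modelling steps, stated, not claimed to hold for QCD)

(M1) GAUSSIAN SWAP ENERGY.  Between two replicas at stiffness distance `ℓ` the swap energy `ΔS` is
Gaussian under the product law; the exact identity `⟨e^{−ΔS}⟩ = 1` (`Exactness/PTBCSwapMonitor`) then
forces mean `ℓ²/2` at variance `ℓ²`, and the stationary acceptance is `⟨min(1, e^{−ΔS})⟩ = erfc(ℓ/(2√2))`
(the tree's `Literature…GaussianMetropolisAcceptance.integral_min_one_exp_neg_gaussianReal_eq_erfc` with
`w = ℓ²`; `Scaling/GaussianAcceptance`: `2Φ(−ℓ/2)`).  The card's canaries A/B/G/H validate (M1) for PTBC to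
`≤ 1 pp` (CARD §9, §12) — a measurement, not used here.
(M2) DIFFUSIVE COST.  The figure of merit of a pair is the expected squared displacement in the stiffness
coordinate per swap attempt, `ESJD(ℓ) = ℓ²·erfc(ℓ/(2√2)) = 8·(u² erfc u)`, `u = ℓ/(2√2)`; equivalently a
ladder of total stiffness `Λ` with uniform spacing `ℓ` has `Λ/ℓ` intervals, a replica performs a
nearest-neighbour walk on it with move probability the acceptance, and its round-trip cost is
`∝ (Λ/ℓ)²/erfc(ℓ/(2√2)) = Λ²/ESJD(ℓ)` (typed in the sequel as `swapESJD`, `ladderCost`).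

## What is proved (reduced spacing `u = ℓ/(2√2)`, `swapEff u = u²·erfc u`, `ESJD(ℓ) = 8·swapEff(ℓ/(2√2))`)

* §1 `hasDerivAt_erf` (`erf′ = (2/√π)e^{−x²}`, FTC), `hasDerivAt_erfc`, `continuous_erfc`,
  **`strictAnti_erfc`**, `erf_zero`, `erfc_zero` (`= 1`).
* §2 `hasDerivAt_swapEff`: `swapEff′(u) = 2u·swapCrit(u)` with the CRITICAL FUNCTION
  `swapCrit u = erfc u − u·e^{−u²}/√π`; `hasDerivAt_swapCrit`: `swapCrit′(u) = −(e^{−u²}/√π)(3 − 2u²)`;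
  `swapCrit_zero = 1`; **`strictAntiOn_swapCrit`** on `[0, 6/5]`; **`swapCrit_neg_of_one_le`** (`u ≥ 1 ⇒
  swapCrit u < 0`, from `erfc_lt_leadFactor`).
* §3 `exists_swapCrit_eq_zero` (IVT on `[0,1]`); **`uOpt`** := that zero; `uOpt_mem_Ioo` (`0 < u⋆ < 1`),
  `swapCrit_uOpt`; `swapCrit_pos_of_lt_uOpt` / `swapCrit_neg_of_uOpt_lt` (the sign pattern, used by the
  enclosure file to bracket `u⋆` from certified signs of `swapCrit`); `swapCrit_eq_zero_iff` (uniqueness);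
  **`strictMonoOn_swapEff`** on `[0, u⋆]`, **`strictAntiOn_swapEff`** on `[u⋆, ∞)`,
  **`swapEff_lt_swapEff_uOpt`** (`u ≥ 0`, `u ≠ u⋆ ⇒ swapEff u < swapEff u⋆`: THE UNIQUE MAXIMISER),
  `isMaxOn_swapEff_uOpt`.
* §4 **`aOpt`** `:= erfc u⋆` — the model's optimal swap acceptance; **`aOpt_eq`**
  (`a⋆ = u⋆e^{−u⋆²}/√π`), `swapEff_uOpt` (`max = u⋆³e^{−u⋆²}/√π`), `aOpt_lt_one`, `aOpt_pos`.
* Sequel `Scaling/SwapAcceptanceOptimum`: physical units (`ESJD(ℓ) = 8·swapEff(ℓ/(2√2))`, the optimal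
  spacing `ℓ⋆ = 2√2·u⋆`), UNIVERSALITY (for every total stiffness `Λ` the round-trip cost
  `(Λ/ℓ)²/erfc(ℓ/(2√2))` is minimised at the same `ℓ⋆`, so `a⋆` does not depend on `Λ`, `β`, `L`, `L_d`:
  "tune every adjacent pair to one acceptance" is the model's optimum — the card's rule), the certified
  enclosure `0.230 < a⋆ < 0.237`, and that the card's `0.20` retains `≥ 92 %` of the optimal efficiency.

Printed counterparts, NAMED ONLY (nothing used): the `0.234` of Roberts–Gelman–Gilks, Ann. Appl. Probab. 7
(1997) 110 (random-walk Metropolis; the same function `ℓ²·2Φ(−ℓ/2)`) and of Atchadé–Roberts–Rosenthal,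
Stat. Comput. 21 (2011) 555 (swap moves of Metropolis-coupled MCMC / parallel tempering, ESJD criterion);
Kone–Kofke, J. Chem. Phys. 122 (2005) 206101 and Rathore–Chopra–de Pablo, J. Chem. Phys. 122 (2005)
024111 (`≈ 20–23 %` under related cost models); Bonanno–Bonati–D'Elia JHEP 03 (2021) 111 (PTBC tuned to
`≈ 20 %`).  Literature grade (cell rule): KNOWN MECHANISM, NEW TYPING (kernel-checked existence, uniqueness
and universality of the optimum for the exact `erfc` model; no asymptotics in a dimension parameter).
NOT CLAIMED: that (M1)/(M2) describe PTBC (measured in the card, not proved); optimal NON-uniform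
acceptance profiles; round-trip or autocorrelation times of any run; any number of ours.
-/

noncomputable section

open Real Set MeasureTheory
open Literature.Analysis.SpecialFunctions (erf)
open Literature.ComputerArithmetic.BrentZimmermann2010.AsymptoticExpansions (erfc leadFactor erfc_pos
  erfc_lt_leadFactor)

namespace Summit.Ventures.LatticeQCDFlow.Scaling

/-! ## §1 Calculus of `erf` / `erfc` -/

section Erf

/-- **`erf′(x) = (2/√π)·e^{−x²}`** (fundamental theorem of calculus on DLMF 7.2.1). [folklore] -/
theorem hasDerivAt_erf (x : ℝ) : HasDerivAt erf (2 / sqrt π * exp (-(x ^ 2))) x := by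
  have hc : Continuous fun t : ℝ => exp (-(t ^ 2)) := by fun_prop
  have h := ((hc.integral_hasStrictDerivAt 0 x).hasDerivAt).const_mul (2 / sqrt π)
  exact h

/-- **`erfc′(x) = −(2/√π)·e^{−x²}`**. [folklore] -/
theorem hasDerivAt_erfc (x : ℝ) : HasDerivAt erfc (-(2 / sqrt π * exp (-(x ^ 2)))) x := by
  have h : HasDerivAt (fun y => 1 - erf y) (0 - 2 / sqrt π * exp (-(x ^ 2))) x :=
    (hasDerivAt_const x (1 : ℝ)).sub (hasDerivAt_erf x)
  rw [zero_sub] at h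
  exact h

/-- `deriv erfc x = −(2/√π)e^{−x²}`. [folklore] -/
theorem deriv_erfc (x : ℝ) : deriv erfc x = -(2 / sqrt π * exp (-(x ^ 2))) := (hasDerivAt_erfc x).deriv

/-- `erfc` is differentiable. [folklore] -/
theorem differentiable_erfc : Differentiable ℝ erfc := fun x => (hasDerivAt_erfc x).differentiableAt

/-- `erfc` is continuous. [folklore] -/
theorem continuous_erfc : Continuous erfc := differentiable_erfc.continuous

/-- `erf` is differentiable. [folklore] -/
theorem differentiable_erf : Differentiable ℝ erf := fun x => (hasDerivAt_erf x).differentiableAt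

/-- `erf` is continuous. [folklore] -/
theorem continuous_erf : Continuous erf := differentiable_erf.continuous

/-- **`erfc` is strictly decreasing on `ℝ`** (its derivative is negative everywhere). [folklore] -/
theorem strictAnti_erfc : StrictAnti erfc := by
  refine strictAnti_of_deriv_neg fun x => ?_
  rw [deriv_erfc]
  have : 0 < 2 / sqrt π * exp (-(x ^ 2)) := by positivity
  linarith

/-- `erf 0 = 0`. [folklore] -/
theorem erf_zero : erf 0 = 0 := by
  simp [erf]

/-- `erfc 0 = 1`. [folklore] -/
theorem erfc_zero : erfc 0 = 1 := by
  simp [erfc, erf_zero]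

/-- `erfc x < 1` for `x > 0`. [folklore] -/
theorem erfc_lt_one_of_pos {x : ℝ} (hx : 0 < x) : erfc x < 1 := by
  rw [← erfc_zero]; exact strictAnti_erfc hx

end Erf

/-! ## §2 The pair efficiency `u² erfc u` and its critical function -/

section Eff

/-- **Swap efficiency in reduced units**: `swapEff u = u²·erfc u`.  With `u = ℓ/(2√2)` this is `1/8` of
the model's expected squared stiffness displacement per swap attempt `ℓ²·erfc(ℓ/(2√2))` (the sequel's
`swapESJD_eq`). [ours] -/
def swapEff (u : ℝ) : ℝ := u ^ 2 * erfc u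

/-- **The critical function** `swapCrit u = erfc u − u·e^{−u²}/√π`: `swapEff′ = 2u·swapCrit`
(`hasDerivAt_swapEff`), so the optimum is its (unique) positive zero. [ours] -/
def swapCrit (u : ℝ) : ℝ := erfc u - u * exp (-(u ^ 2)) / sqrt π

/-- `d/du (u·e^{−u²}/√π) = e^{−u²}(1 − 2u²)/√π`. [folklore] -/
theorem hasDerivAt_mul_exp_neg_sq (u : ℝ) :
    HasDerivAt (fun v : ℝ => v * exp (-(v ^ 2)) / sqrt π) (exp (-(u ^ 2)) * (1 - 2 * u ^ 2) / sqrt π) u := by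
  have h0 : HasDerivAt (fun v : ℝ => v ^ 2) (2 * u) u := by simpa using hasDerivAt_pow 2 u
  have h1 : HasDerivAt (fun v : ℝ => -(v ^ 2)) (-(2 * u)) u := h0.neg
  have h2 : HasDerivAt (fun v : ℝ => exp (-(v ^ 2))) (exp (-(u ^ 2)) * (-(2 * u))) u := h1.exp
  have h3 : HasDerivAt (fun v : ℝ => v * exp (-(v ^ 2)))
      (1 * exp (-(u ^ 2)) + u * (exp (-(u ^ 2)) * (-(2 * u)))) u := (hasDerivAt_id' u).mul h2
  have h4 : HasDerivAt (fun v : ℝ => v * exp (-(v ^ 2)) / sqrt π)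
      ((1 * exp (-(u ^ 2)) + u * (exp (-(u ^ 2)) * (-(2 * u)))) / sqrt π) u := h3.div_const (sqrt π)
  convert h4 using 1
  ring

/-- **`swapEff′(u) = 2u·swapCrit(u)`**: `d/du(u² erfc u) = 2u·erfc u − (2/√π)u²e^{−u²}
= 2u·(erfc u − u e^{−u²}/√π)`. [ours] -/
theorem hasDerivAt_swapEff (u : ℝ) : HasDerivAt swapEff (2 * u * swapCrit u) u := by
  have h1 : HasDerivAt (fun v : ℝ => v ^ 2) (2 * u) u := by simpa using hasDerivAt_pow 2 u
  have h2 : HasDerivAt (fun v : ℝ => v ^ 2 * erfc v)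
      (2 * u * erfc u + u ^ 2 * (-(2 / sqrt π * exp (-(u ^ 2))))) u := h1.mul (hasDerivAt_erfc u)
  have e : (fun v : ℝ => v ^ 2 * erfc v) = swapEff := rfl
  rw [e] at h2
  convert h2 using 1
  simp only [swapCrit]
  field_simp
  ring

/-- **`swapCrit′(u) = −(e^{−u²}/√π)·(3 − 2u²)`**. [ours] -/
theorem hasDerivAt_swapCrit (u : ℝ) :
    HasDerivAt swapCrit (-(exp (-(u ^ 2)) / sqrt π * (3 - 2 * u ^ 2))) u := by
  have h : HasDerivAt (fun v : ℝ => erfc v - v * exp (-(v ^ 2)) / sqrt π)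
      (-(2 / sqrt π * exp (-(u ^ 2))) - exp (-(u ^ 2)) * (1 - 2 * u ^ 2) / sqrt π) u :=
    (hasDerivAt_erfc u).sub (hasDerivAt_mul_exp_neg_sq u)
  have e : (fun v : ℝ => erfc v - v * exp (-(v ^ 2)) / sqrt π) = swapCrit := rfl
  rw [e] at h
  convert h using 1
  field_simp
  ring

/-- `deriv swapCrit`. [ours] -/
theorem deriv_swapCrit (u : ℝ) : deriv swapCrit u = -(exp (-(u ^ 2)) / sqrt π * (3 - 2 * u ^ 2)) :=
  (hasDerivAt_swapCrit u).deriv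

/-- `deriv swapEff`. [ours] -/
theorem deriv_swapEff (u : ℝ) : deriv swapEff u = 2 * u * swapCrit u := (hasDerivAt_swapEff u).deriv

/-- `swapCrit` is continuous. [ours] -/
theorem continuous_swapCrit : Continuous swapCrit :=
  (show Differentiable ℝ swapCrit from fun u => (hasDerivAt_swapCrit u).differentiableAt).continuous

/-- `swapEff` is continuous. [ours] -/
theorem continuous_swapEff : Continuous swapEff :=
  (show Differentiable ℝ swapEff from fun u => (hasDerivAt_swapEff u).differentiableAt).continuous

/-- `swapCrit 0 = 1`. [ours] -/
theorem swapCrit_zero : swapCrit 0 = 1 := by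
  simp [swapCrit, erfc_zero]

/-- **`swapCrit` is strictly decreasing on `[0, 6/5]`** (its derivative `−(e^{−u²}/√π)(3 − 2u²)` is
negative while `u² < 3/2`). [ours] -/
theorem strictAntiOn_swapCrit : StrictAntiOn swapCrit (Icc 0 (6 / 5)) := by
  refine strictAntiOn_of_deriv_neg (convex_Icc _ _) continuous_swapCrit.continuousOn fun x hx => ?_
  rw [interior_Icc] at hx
  rw [deriv_swapCrit]
  have h1 : 0 < exp (-(x ^ 2)) / sqrt π := by positivity
  have h2 : 0 < 3 - 2 * x ^ 2 := by nlinarith [hx.1, hx.2]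
  have := mul_pos h1 h2
  linarith

/-- **`swapCrit u < 0` for `u ≥ 1`**: `erfc u < e^{−u²}/(u√π) ≤ u·e^{−u²}/√π` (the first inequality is
the tree's `erfc_lt_leadFactor`, the leading term of the asymptotic expansion being an upper bound).
[ours] -/
theorem swapCrit_neg_of_one_le {u : ℝ} (hu : 1 ≤ u) : swapCrit u < 0 := by
  have hu0 : 0 < u := by linarith
  have h1 : erfc u < leadFactor u := erfc_lt_leadFactor hu0
  have hπ : 0 < sqrt π := by positivity
  have hac : 0 < exp (-(u ^ 2)) * sqrt π := by positivity
  have h2 : leadFactor u ≤ u * exp (-(u ^ 2)) / sqrt π := by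
    unfold leadFactor
    rw [div_le_div_iff₀ (by positivity) hπ]
    have hu2 : 1 ≤ u ^ 2 := by nlinarith
    nlinarith [mul_nonneg (sub_nonneg.2 hu2) hac.le]
  simp only [swapCrit]
  linarith

end Eff

/-! ## §3 The unique maximiser `u⋆` -/

section Opt

/-- `swapCrit` has a zero in `(0, 1)` (intermediate value theorem: `swapCrit 0 = 1 > 0 > swapCrit 1`).
[ours] -/
theorem exists_swapCrit_eq_zero : ∃ u ∈ Ioo (0 : ℝ) 1, swapCrit u = 0 := by
  have hIVT := intermediate_value_Ioo' (zero_le_one : (0 : ℝ) ≤ 1) continuous_swapCrit.continuousOn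
  have h0 : (0 : ℝ) ∈ Ioo (swapCrit 1) (swapCrit 0) := by
    rw [swapCrit_zero]
    exact ⟨swapCrit_neg_of_one_le le_rfl, zero_lt_one⟩
  obtain ⟨u, hu, hzero⟩ := hIVT h0
  exact ⟨u, hu, hzero⟩

/-- **The optimal reduced spacing `u⋆`**: the zero of `swapCrit` in `(0, 1)` (unique by
`swapCrit_eq_zero_iff`; the maximiser of `swapEff` by `swapEff_lt_swapEff_uOpt`). [ours] -/
def uOpt : ℝ := exists_swapCrit_eq_zero.choose

/-- `0 < u⋆ < 1`. [ours] -/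
theorem uOpt_mem_Ioo : uOpt ∈ Ioo (0 : ℝ) 1 := exists_swapCrit_eq_zero.choose_spec.1

/-- `u⋆ > 0`. [ours] -/
theorem uOpt_pos : 0 < uOpt := uOpt_mem_Ioo.1

/-- `u⋆ < 1`. [ours] -/
theorem uOpt_lt_one : uOpt < 1 := uOpt_mem_Ioo.2

/-- `swapCrit u⋆ = 0`. [ours] -/
theorem swapCrit_uOpt : swapCrit uOpt = 0 := exists_swapCrit_eq_zero.choose_spec.2

/-- **Left of `u⋆` the critical function is positive** (`0 ≤ u < u⋆`). [ours] -/
theorem swapCrit_pos_of_lt_uOpt {u : ℝ} (hu0 : 0 ≤ u) (hu : u < uOpt) : 0 < swapCrit u := by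
  rw [← swapCrit_uOpt]
  exact strictAntiOn_swapCrit ⟨hu0, by linarith [uOpt_lt_one]⟩
    ⟨uOpt_pos.le, by linarith [uOpt_lt_one]⟩ hu

/-- **Right of `u⋆` the critical function is negative** (`u⋆ < u`). [ours] -/
theorem swapCrit_neg_of_uOpt_lt {u : ℝ} (hu : uOpt < u) : swapCrit u < 0 := by
  by_cases h : u ≤ 6 / 5
  · rw [← swapCrit_uOpt]
    exact strictAntiOn_swapCrit ⟨uOpt_pos.le, by linarith [uOpt_lt_one]⟩ ⟨by linarith [uOpt_pos], h⟩ hu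
  · exact swapCrit_neg_of_one_le (by linarith)

/-- **Uniqueness**: for `u ≥ 0`, `swapCrit u = 0 ↔ u = u⋆`. [ours] -/
theorem swapCrit_eq_zero_iff {u : ℝ} (hu0 : 0 ≤ u) : swapCrit u = 0 ↔ u = uOpt := by
  refine ⟨fun h => ?_, fun h => h ▸ swapCrit_uOpt⟩
  rcases lt_trichotomy u uOpt with hlt | heq | hgt
  · exact absurd h (swapCrit_pos_of_lt_uOpt hu0 hlt).ne'
  · exact heq
  · exact absurd h (swapCrit_neg_of_uOpt_lt hgt).ne

/-- **Bracketing criterion, left**: a certified `swapCrit u > 0` puts `u` left of `u⋆`.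
[ours] -/
theorem lt_uOpt_of_swapCrit_pos {u : ℝ} (h : 0 < swapCrit u) : u < uOpt := by
  by_contra hle
  rcases eq_or_lt_of_le (not_lt.mp hle) with heq | hlt
  · rw [← heq, swapCrit_uOpt] at h; exact lt_irrefl _ h
  · exact absurd h (not_lt.mpr (swapCrit_neg_of_uOpt_lt hlt).le)

/-- **Bracketing criterion, right**: a certified `swapCrit u < 0` at some `u ≥ 0` puts `u` right of `u⋆`.
[ours] -/
theorem uOpt_lt_of_swapCrit_neg {u : ℝ} (hu0 : 0 ≤ u) (h : swapCrit u < 0) : uOpt < u := by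
  by_contra hle
  rcases eq_or_lt_of_le (not_lt.mp hle) with heq | hlt
  · rw [heq, swapCrit_uOpt] at h; exact lt_irrefl _ h
  · exact absurd h (not_lt.mpr (swapCrit_pos_of_lt_uOpt hu0 hlt).le)

/-- **`swapEff` is strictly increasing on `[0, u⋆]`.** [ours] -/
theorem strictMonoOn_swapEff : StrictMonoOn swapEff (Icc 0 uOpt) := by
  refine strictMonoOn_of_deriv_pos (convex_Icc _ _) continuous_swapEff.continuousOn fun x hx => ?_
  rw [interior_Icc] at hx
  rw [deriv_swapEff]
  exact mul_pos (by linarith [hx.1]) (swapCrit_pos_of_lt_uOpt hx.1.le hx.2)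

/-- **`swapEff` is strictly decreasing on `[u⋆, ∞)`.** [ours] -/
theorem strictAntiOn_swapEff : StrictAntiOn swapEff (Ici uOpt) := by
  refine strictAntiOn_of_deriv_neg (convex_Ici _) continuous_swapEff.continuousOn fun x hx => ?_
  rw [interior_Ici] at hx
  rw [deriv_swapEff]
  have hx0 : 0 < x := lt_trans uOpt_pos hx
  have := mul_pos (by linarith : 0 < 2 * x) (neg_pos.mpr (swapCrit_neg_of_uOpt_lt hx))
  linarith

/-- **`u⋆` IS THE UNIQUE MAXIMISER of the swap efficiency on `u ≥ 0`.** [ours] -/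
theorem swapEff_lt_swapEff_uOpt {u : ℝ} (hu0 : 0 ≤ u) (hne : u ≠ uOpt) : swapEff u < swapEff uOpt := by
  rcases lt_or_gt_of_ne hne with hlt | hgt
  · exact strictMonoOn_swapEff ⟨hu0, hlt.le⟩ ⟨uOpt_pos.le, le_rfl⟩ hlt
  · exact strictAntiOn_swapEff (self_mem_Ici) (mem_Ici.2 hgt.le) hgt

/-- `swapEff u ≤ swapEff u⋆` for every `u ≥ 0`. [ours] -/
theorem swapEff_le_swapEff_uOpt {u : ℝ} (hu0 : 0 ≤ u) : swapEff u ≤ swapEff uOpt := by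
  by_cases h : u = uOpt
  · rw [h]
  · exact (swapEff_lt_swapEff_uOpt hu0 h).le

/-- `u⋆` is a maximum of `swapEff` on `[0, ∞)`. [ours] -/
theorem isMaxOn_swapEff_uOpt : IsMaxOn swapEff (Ici 0) uOpt := fun _ hu => swapEff_le_swapEff_uOpt hu

end Opt

/-! ## §4 The optimal acceptance `a⋆ = erfc u⋆ = u⋆e^{−u⋆²}/√π` -/

section Acc

/-- **The model's optimal swap acceptance** `a⋆ = erfc u⋆`: the stationary acceptance of a pair placed at
the efficiency-maximising stiffness distance `ℓ⋆ = 2√2·u⋆`. [ours] -/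
def aOpt : ℝ := erfc uOpt

/-- **`a⋆ = u⋆·e^{−u⋆²}/√π`** (the critical equation `swapCrit u⋆ = 0`). [ours] -/
theorem aOpt_eq : aOpt = uOpt * exp (-(uOpt ^ 2)) / sqrt π := by
  have h := swapCrit_uOpt
  simp only [swapCrit] at h
  unfold aOpt
  linarith

/-- The maximal efficiency is `swapEff u⋆ = u⋆³e^{−u⋆²}/√π`. [ours] -/
theorem swapEff_uOpt : swapEff uOpt = uOpt ^ 3 * exp (-(uOpt ^ 2)) / sqrt π := by
  have h : erfc uOpt = uOpt * exp (-(uOpt ^ 2)) / sqrt π := aOpt_eq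
  simp only [swapEff, h]
  ring

/-- `0 < a⋆`. [ours] -/
theorem aOpt_pos : 0 < aOpt := erfc_pos _

/-- `a⋆ < 1`. [ours] -/
theorem aOpt_lt_one : aOpt < 1 := erfc_lt_one_of_pos uOpt_pos

end Acc

end Summit.Ventures.LatticeQCDFlow.Scaling

end
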